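import Summits.BirchSwinnertonDyer.Rank1Residual.Additive.TateThreeIntegralStar
import Summits.BirchSwinnertonDyer.Rank1Residual.Additive.TypeGThree
import Summits.BirchSwinnertonDyer.BirchSwinnertonDyer.Theorems.Rank1ResidualIntModelReduction
import Literature.NumberTheory.EllipticCurves.QuadraticTwistJInvariantProofs
import HarnessLib

/-!
# Additive at `3` with `ord₃ j = 0` ⟹ the twist `E^{(−3)}` is GOOD at `3` ⟹ Delbourgo's (G) at `p = 3`

HONEST FRAMING (cell `b2b-bsdres`, run/shared/lean/b2b/bsd-rank1-residual/, verbatim in every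
file): the goal of the cell is to DELETE the COMBINATION-SHAPED residual classes of the
Birch–Swinnerton-Dyer formula for ALL analytic-rank `≤ 1` elliptic curves over `ℚ` — "full BSD
formula for every rank `≤ 1` curve in class `C`" assembled STRICTLY from published theorems — so
that the rank-`≤ 1` remainder becomes exactly the CONSTRUCTION-SHAPED classes, which are TYPED
(missing-input `Prop`s), NOT attempted. This is not "finishing BSD". Sub-cell `additive-p2`
(X3♯(G-ord)/X4♯(G-ord): additive `p`, potentially good ORDINARY), generation 10: research route;
no claim beyond the stated classes; theorems only, no definition, no named fact;
X3♯(G-ord)/X4♯(G-ord) stay CONSTRUCTION-SHAPED; labels / census / located gap UNCHANGED.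

WHAT THIS FILE DOES. The converse half of the sub-cell's dictionary at `p = 3` that gen 7–9 left
open: **`E` additive at `3` with `j(E)` a `3`-adic unit (`j ≠ 0`, `ord₃ j = 0`) ⟹ every model of
the quadratic twist `E^{(−3)}` has GOOD reduction at `3`, hence `TypeG W 3`** (Delbourgo's (G):
good reduction over `ℚ(ζ₃) = ℚ(√−3)`). With gen 7's `typeG_three_iff_good_twist` /
`typeGOrd_three_iff_goodOrd_twist` and the characteristic-`3` Deuring lemma (`DeuringThree.lean`)
this yields the datum-free dictionary `TypeGOrd W 3 ↔ (j ≠ 0 ∧ ord₃ j = 0)` on the additive locus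
(`PotentiallyOrdinaryThree.lean`).

PROOF (Tate's algorithm at `3`, run in the kernel on integers — `TateThreeIntegral*.lean`): let
`E₀ = integralModelInt W` (`W` globally minimal) and `M = (½, 0, −a₁/2, −a₃/2) • W =
y² = x³ + Ax² + Bx + C` with `A = b₂`, `B = 8b₄`, `C = 16b₆ ∈ ℤ`; then `c₄(W) = A² − 3B` and
`2⁸Δ(W) = disc(x³ + Ax² + Bx + C)`. Additive reduction gives `3 ∣ c₄`, `3 ∣ Δ`
(`hasGoodReductionAtPrime_of_not_dvd`, `hasMultiplicativeReductionAtPrime_of_intModel`), and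
`ord₃ j = 0` gives `ord₃ Δ = 3 ord₃ c₄`. `TateThree.main` then produces an integer translation
`x ↦ x + t` with EITHER `3 ∥ A'`, `9 ∣ B'`, `27 ∣ C'` — and then
`(3, 0, 0, 0) • M_t^{(−3)} = y² = x³ − (A'/3)x² + (B'/9)x − C'/27` is `3`-integral with
discriminant `2¹²Δ(W)/3⁶`, a `3`-adic unit (`ord₃ Δ = 6`): a GOOD model of `E^{(−3)}`
(`hasGoodReductionAt_of_valuation_le_one_of_valuation_Δ_eq_one`, model invariance
`hasGoodReductionAt_smul_iff_holds`, `quadraticTwist_smul`) — OR `9 ∣ A'`, `81 ∣ B'`, `729 ∣ C'`,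
and then `(3, 0, 0, 0) • M_t` is a `3`-integral model of `E` with discriminant `2¹²Δ(W)/3¹²`,
contradicting the minimality of `W` at `3` (`valuation_Δ_smul_le_of_isMinimalAt`). MAIN:
`hasGoodReductionAtPrime_twist_three_of_padicValRat_j_eq_zero`,
**`typeG_three_of_padicValRat_j_eq_zero`**. In print (statements): Serre–Tate 1968 §2 Cor. 2(b)
(inertia acts through `Aut Ẽ`, of order `2` when `j̃ ≠ 0, 1728`); Silverman *ATAEC* IV.9.4,
Ex. 4.49; Kraus, Manuscripta Math. 69 (1990). No Galois representation or Néron model is used.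
-/

noncomputable section

open scoped Classical NumberField

open WeierstrassCurve IsDedekindDomain IsDedekindDomain.HeightOneSpectrum NumberField IsLocalRing
  WithZero Literature.NumberTheory.EllipticCurves Literature.NumberTheory.EllipticCurves.Rank1Residual
  Summit.BirchSwinnertonDyer.BirchSwinnertonDyer.Rank1Residual.IntModel

namespace Summit.BirchSwinnertonDyer.Rank1Residual.Additive

/-! ### The integer data of a globally minimal model: `c₄ = A² − 3B`, `2⁸Δ = disc` -/

section IntegerData

/-- `c₄ = b₂² − 24 b₄ = A² − 3B` with `A = b₂`, `B = 8b₄` (Silverman *AEC* III.1). [folklore] -/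
theorem c₄_eq_b₂_sq_sub {R : Type*} [CommRing R] (E₀ : WeierstrassCurve R) :
    E₀.c₄ = E₀.b₂ ^ 2 - 3 * (8 * E₀.b₄) := by
  rw [WeierstrassCurve.c₄]; ring

/-- `2⁸ Δ = A²B² − 4B³ − 4A³C − 27C² + 18ABC` with `A = b₂`, `B = 8b₄`, `C = 16b₆` (the
discriminant of `x³ + Ax² + Bx + C`; `4b₈ = b₂b₆ − b₄²`, Silverman *AEC* III.1). [folklore] -/
theorem disc_b_eq {R : Type*} [CommRing R] (E₀ : WeierstrassCurve R) :
    E₀.b₂ ^ 2 * (8 * E₀.b₄) ^ 2 - 4 * (8 * E₀.b₄) ^ 3 - 4 * E₀.b₂ ^ 3 * (16 * E₀.b₆)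
      - 27 * (16 * E₀.b₆) ^ 2 + 18 * E₀.b₂ * (8 * E₀.b₄) * (16 * E₀.b₆) = 256 * E₀.Δ := by
  have hb := E₀.b_relation
  simp only [WeierstrassCurve.Δ]
  linear_combination (64 * E₀.b₂ ^ 2) * hb

variable (W : WeierstrassCurve ℚ) [W.IsElliptic] [W.IsGloballyMinimal]

omit [W.IsElliptic] in
/-- Additive (indeed: not good) reduction at `3` gives `3 ∣ Δ_min`. [folklore] -/
theorem three_dvd_Δ_of_not_good (hbad : ¬ W.HasGoodReductionAtPrime 3) :
    (3 : ℤ) ∣ (integralModelInt W).Δ := by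
  by_contra h
  exact hbad (hasGoodReductionAtPrime_of_not_dvd W 3 (by exact_mod_cast h))

/-- Additive reduction at `3` gives `3 ∣ c₄` of the integral model (else the reduction would be
multiplicative, Silverman *AEC* VII.5.1(b)). [folklore] -/
theorem three_dvd_c₄_of_addv (hadd : Addv W 3) : (3 : ℤ) ∣ (integralModelInt W).c₄ := by
  by_contra h
  exact hadd.2 (hasMultiplicativeReductionAtPrime_of_intModel (W := W) rfl 3
    (by exact_mod_cast three_dvd_Δ_of_not_good W hadd.1) (by exact_mod_cast h))

/-- `ord₃ j = 0` (`j ≠ 0`) on the integral model: `c₄ ≠ 0` and `3·ord₃ c₄ = ord₃ Δ_min`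
(`j = c₄³/Δ`). [folklore] -/
theorem padicValInt_c₄_of_padicValRat_j_eq_zero (hj0 : W.j ≠ 0) (hj : padicValRat 3 W.j = 0) :
    (integralModelInt W).c₄ ≠ 0 ∧
      3 * padicValInt 3 (integralModelInt W).c₄ = padicValInt 3 (integralModelInt W).Δ := by
  have hc : W.c₄ = ((integralModelInt W).c₄ : ℚ) := c₄_eq_cast rfl
  have hΔ : W.Δ = ((integralModelInt W).Δ : ℚ) := Δ_eq_cast rfl
  have hΔ0 : (integralModelInt W).Δ ≠ 0 := minimalDiscriminantInt_ne_zero W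
  have hjq : W.j = W.c₄ ^ 3 / W.Δ := by
    rw [WeierstrassCurve.j, ← coe_Δ', div_eq_inv_mul, Units.val_inv_eq_inv_val]
  have hc0 : (integralModelInt W).c₄ ≠ 0 := by
    intro h0
    apply hj0
    rw [hjq, hc, h0]; simp
  refine ⟨hc0, ?_⟩
  rw [hjq, hc, hΔ, padicValRat.div (pow_ne_zero _ (by exact_mod_cast hc0)) (by exact_mod_cast hΔ0),
    padicValRat.pow, padicValRat.of_int, padicValRat.of_int] at hj
  have h := hj
  push_cast at h
  omega

/-- `3^n ∣ a ↔ a = 0 ∨ n ≤ ord₃ a` (Mathlib `padicValInt_dvd_iff` at `p = 3`). [folklore] -/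
theorem three_pow_dvd_iff (n : ℕ) (a : ℤ) : (3 : ℤ) ^ n ∣ a ↔ a = 0 ∨ n ≤ padicValInt 3 a := by
  simpa using padicValInt_dvd_iff (p := 3) n a

end IntegerData

/-! ### The main theorem -/

section Main

variable (W : WeierstrassCurve ℚ) [W.IsElliptic] [W.IsGloballyMinimal]

/-- At the place `u ∋ 3` of `ℚ` an integer has valuation `≤ 1`. [folklore] -/
theorem valuation_intCast_le_one (u : HeightOneSpectrum (𝓞 ℚ)) (hu : ((3 : ℕ) : 𝓞 ℚ) ∈ u.asIdeal)
    (n : ℤ) : u.valuation ℚ (n : ℚ) ≤ 1 := by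
  rw [valuation_le_one_iff_padicValuation_three u hu, Rat.padicValuation_cast]
  exact Int.padicValuation_le_one 3 _

/-- **Additive at `3` with `ord₃ j = 0` ⟹ `E^{(−3)}` is good at `3`.** For `E/ℚ` with globally
minimal model `W`, additive at `3`, `j(E) ≠ 0` and `ord₃ j(E) = 0`: the quadratic twist
`W^{(p*)}`, `p* = −3`, has good reduction at `3`. Tate's algorithm (`TateThree.main`) on the
integer cubic model `y² = x³ + b₂x² + 8b₄x + 16b₆` of `E`; in the `I₀*` case
`y² = x³ − (A'/3)x² + (B'/9)x − C'/27` is a good model of the twist, in the other case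
`y² = x³ + (A'/9)x² + (B'/81)x + C'/729` contradicts minimality at `3`. In print: Silverman
*ATAEC* IV.9 Ex. 4.49 (`I₀*` becomes `I₀` over a ramified quadratic extension), Serre–Tate 1968
§2 (inertia ↪ `Aut Ẽ = {±1}` when `j̃ ≠ 0` in characteristic `3`).
[cite: SilvermanATAEC1994, IV.9.4 and Exercise 4.49] -/
theorem hasGoodReductionAtPrime_twist_three_of_padicValRat_j_eq_zero (hadd : Addv W 3)
    (hj0 : W.j ≠ 0) (hj : padicValRat 3 W.j = 0) :
    (W.quadraticTwist ((-1 : ℚ) ^ ((3 : ℕ) / 2) * (3 : ℕ))).HasGoodReductionAtPrime 3 := by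
  rw [pStar_three]
  -- integer data
  obtain ⟨hc0, hval⟩ := padicValInt_c₄_of_padicValRat_j_eq_zero W hj0 hj
  have hΔ' : W.Δ = ((integralModelInt W).Δ : ℚ) := Δ_eq_cast rfl
  set E₀ : WeierstrassCurve ℤ := integralModelInt W with hE₀
  set A : ℤ := E₀.b₂ with hA
  set B : ℤ := 8 * E₀.b₄ with hB
  set C : ℤ := 16 * E₀.b₆ with hC
  have hc4E : E₀.c₄ = A ^ 2 - 3 * B := c₄_eq_b₂_sq_sub E₀
  have hDE : A ^ 2 * B ^ 2 - 4 * B ^ 3 - 4 * A ^ 3 * C - 27 * C ^ 2 + 18 * A * B * C =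
      256 * E₀.Δ := disc_b_eq E₀
  have h3c : (3 : ℤ) ∣ A ^ 2 - 3 * B := hc4E ▸ three_dvd_c₄_of_addv W hadd
  have h3D : (3 : ℤ) ∣ A ^ 2 * B ^ 2 - 4 * B ^ 3 - 4 * A ^ 3 * C - 27 * C ^ 2 + 18 * A * B * C := by
    rw [hDE]; exact dvd_mul_of_dvd_right (three_dvd_Δ_of_not_good W hadd.1) _
  have hcD : ∀ k : ℕ, (3 : ℤ) ^ k ∣ A ^ 2 - 3 * B →
      (3 : ℤ) ^ (3 * k) ∣ A ^ 2 * B ^ 2 - 4 * B ^ 3 - 4 * A ^ 3 * C - 27 * C ^ 2 + 18 * A * B * C := by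
    intro k hk
    rw [hDE]
    refine dvd_mul_of_dvd_right ?_ _
    rw [← hc4E, three_pow_dvd_iff] at hk
    rw [three_pow_dvd_iff]
    right
    have := hk.resolve_left hc0
    omega
  -- the models
  have hW : E₀.map (Int.castRingHom ℚ) = W := map_integralModelInt W
  have ha₁ : W.a₁ = (E₀.a₁ : ℚ) := by
    conv_lhs => rw [← hW]
    simp
  have ha₂ : W.a₂ = (E₀.a₂ : ℚ) := by
    conv_lhs => rw [← hW]
    simp
  have ha₃ : W.a₃ = (E₀.a₃ : ℚ) := by
    conv_lhs => rw [← hW]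
    simp
  have ha₄ : W.a₄ = (E₀.a₄ : ℚ) := by
    conv_lhs => rw [← hW]
    simp
  have ha₆ : W.a₆ = (E₀.a₆ : ℚ) := by
    conv_lhs => rw [← hW]
    simp
  set C₀ : VariableChange ℚ :=
    ⟨Units.mk0 (2⁻¹ : ℚ) (by norm_num), 0, -(E₀.a₁ : ℚ) / 2, -(E₀.a₃ : ℚ) / 2⟩ with hC₀def
  have hC₀u : (↑C₀.u⁻¹ : ℚ) = 2 := by
    rw [Units.val_inv_eq_inv_val, hC₀def, Units.val_mk0, inv_inv]
  set M := C₀ • W with hMdef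
  have hM₁ : M.a₁ = 0 := by rw [hMdef, variableChange_a₁, hC₀u, hC₀def, ha₁]; ring
  have hM₂ : M.a₂ = (A : ℚ) := by
    rw [hMdef, variableChange_a₂, hC₀u, hC₀def, ha₁, ha₂, hA, WeierstrassCurve.b₂]; push_cast; ring
  have hM₃ : M.a₃ = 0 := by rw [hMdef, variableChange_a₃, hC₀u, hC₀def, ha₁, ha₃]; ring
  have hM₄ : M.a₄ = (B : ℚ) := by
    rw [hMdef, variableChange_a₄, hC₀u, hC₀def, ha₁, ha₂, ha₃, ha₄, hB, WeierstrassCurve.b₄]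
    push_cast; ring
  have hM₆ : M.a₆ = (C : ℚ) := by
    rw [hMdef, variableChange_a₆, hC₀u, hC₀def, ha₁, ha₂, ha₃, ha₄, ha₆, hC, WeierstrassCurve.b₆]
    push_cast; ring
  have hMΔ : M.Δ = 2 ^ 12 * W.Δ := by rw [hMdef, variableChange_Δ, hC₀u]
  -- the place of `𝓞 ℚ` at `3`; `W` is minimal there
  set u₃ : HeightOneSpectrum (𝓞 ℚ) :=
    (Rat.HeightOneSpectrum.primesEquiv (R := 𝓞 ℚ)).symm ⟨3, Nat.prime_three⟩ with hu₃def
  have hu₃ : ((3 : ℕ) : 𝓞 ℚ) ∈ u₃.asIdeal :=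
    (natCast_mem_asIdeal_iff_eq_primesEquiv_symm u₃ Nat.prime_three).mpr rfl
  have hmin : W.IsMinimalAt u₃ := IsGloballyMinimal.isMinimal u₃
  rcases TateThree.main h3c h3D hcD with ⟨t, h3A, h9A, h9B, h27C⟩ | ⟨t, h9A, h81B, h729C⟩
  · -- Case `I₀*`: a good model of the twist
    set Ct : VariableChange ℚ := ⟨1, (t : ℚ), 0, 0⟩ with hCtdef
    set Mt := Ct • M with hMtdef
    have hMt₁ : Mt.a₁ = 0 := by rw [hMtdef, variableChange_a₁, hM₁, hCtdef]; simp
    have hMt₂ : Mt.a₂ = ((A + 3 * t : ℤ) : ℚ) := by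
      rw [hMtdef, variableChange_a₂, hM₁, hM₂, hCtdef]; push_cast; simp
    have hMt₃ : Mt.a₃ = 0 := by rw [hMtdef, variableChange_a₃, hM₁, hM₃, hCtdef]; simp
    have hMt₄ : Mt.a₄ = ((B + 2 * A * t + 3 * t ^ 2 : ℤ) : ℚ) := by
      rw [hMtdef, variableChange_a₄, hM₁, hM₂, hM₃, hM₄, hCtdef]; push_cast; simp; ring
    have hMt₆ : Mt.a₆ = ((C + B * t + A * t ^ 2 + t ^ 3 : ℤ) : ℚ) := by
      rw [hMtdef, variableChange_a₆, hM₁, hM₂, hM₃, hM₄, hM₆, hCtdef]; push_cast; simp; ring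
    have hMtΔ : Mt.Δ = 2 ^ 12 * W.Δ := by rw [hMtdef, variableChange_Δ, hCtdef, hMΔ]; simp
    -- `ord₃ Δ = 6`
    obtain ⟨h9c, h27c⟩ := TateThree.c_of_caseOne h3A h9A h9B
    rw [TateThree.c_translate, ← hc4E] at h9c h27c
    have hv2 : padicValInt 3 E₀.c₄ = 2 := by
      have h1 := ((three_pow_dvd_iff 2 _).mp h9c).resolve_left hc0
      have h2 : ¬ (3 ≤ padicValInt 3 E₀.c₄) := fun h ↦ h27c ((three_pow_dvd_iff 3 _).mpr (Or.inr h))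
      omega
    have hvΔ : padicValInt 3 E₀.Δ = 6 := by omega
    -- the twisted model
    haveI : NeZero (2 : ℚ) := ⟨two_ne_zero⟩
    set V := W.quadraticTwist (-3 : ℚ) with hVdef
    set Vt := Mt.quadraticTwist (-3 : ℚ) with hVtdef
    set C3 : VariableChange ℚ := ⟨Units.mk0 (3 : ℚ) (by norm_num), 0, 0, 0⟩ with hC3def
    have hC3u : (↑C3.u⁻¹ : ℚ) = 3⁻¹ := by rw [Units.val_inv_eq_inv_val, hC3def, Units.val_mk0]
    set T := C3 • Vt with hTdef
    obtain ⟨y₂, hy₂⟩ := h3A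
    obtain ⟨y₄, hy₄⟩ := h9B
    obtain ⟨y₆, hy₆⟩ := h27C
    have hVt₁ : Vt.a₁ = 0 := by rw [hVtdef, quadraticTwist_a₁]
    have hVt₃ : Vt.a₃ = 0 := by rw [hVtdef, quadraticTwist_a₃]
    have hVt₂ : Vt.a₂ = -3 * ((A + 3 * t : ℤ) : ℚ) := by
      rw [hVtdef, quadraticTwist_a₂, WeierstrassCurve.b₂, hMt₁, hMt₂]; ring
    have hVt₄ : Vt.a₄ = 9 * ((B + 2 * A * t + 3 * t ^ 2 : ℤ) : ℚ) := by
      rw [hVtdef, quadraticTwist_a₄, WeierstrassCurve.b₄, hMt₁, hMt₃, hMt₄]; ring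
    have hVt₆ : Vt.a₆ = -27 * ((C + B * t + A * t ^ 2 + t ^ 3 : ℤ) : ℚ) := by
      rw [hVtdef, quadraticTwist_a₆, WeierstrassCurve.b₆, hMt₃, hMt₆]; ring
    have hT₁ : T.a₁ = 0 := by rw [hTdef, variableChange_a₁, hVt₁, hC3def]; simp
    have hT₃ : T.a₃ = 0 := by rw [hTdef, variableChange_a₃, hVt₁, hVt₃, hC3def]; simp
    have hT₂ : T.a₂ = ((-y₂ : ℤ) : ℚ) := by
      rw [hTdef, variableChange_a₂, hC3u, hVt₁, hVt₂, hy₂, hC3def]; push_cast; ring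
    have hT₄ : T.a₄ = ((y₄ : ℤ) : ℚ) := by
      rw [hTdef, variableChange_a₄, hC3u, hVt₁, hVt₂, hVt₃, hVt₄, hy₄, hC3def]; push_cast; ring
    have hT₆ : T.a₆ = ((-y₆ : ℤ) : ℚ) := by
      rw [hTdef, variableChange_a₆, hC3u, hVt₁, hVt₂, hVt₃, hVt₄, hVt₆, hy₆, hC3def]; push_cast; ring
    have hTΔ : T.Δ = W.Δ * 2 ^ 12 / (3 ^ 6 * (1 : ℤ)) := by
      rw [hTdef, variableChange_Δ, hC3u, hVtdef, quadraticTwist_Δ, hMtΔ]; push_cast; ring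
    have hΔv : Rat.padicValuation 3 (W.Δ * 2 ^ 12) = exp (-((6 : ℕ) : ℤ)) := by
      have h0 : W.Δ * 2 ^ 12 ≠ 0 := mul_ne_zero W.isUnit_Δ.ne_zero (by norm_num)
      rw [padicValuation_three_apply h0, padicValRat.mul W.isUnit_Δ.ne_zero (by norm_num), hΔ',
        padicValRat.of_int, hvΔ, padicValRat.pow]
      have h2 : padicValRat 3 (2 : ℚ) = 0 := by
        rw [show (2 : ℚ) = ((2 : ℕ) : ℚ) by norm_num, padicValRat.of_nat]
        simp [padicValNat.eq_zero_of_not_dvd (show ¬ 3 ∣ 2 by norm_num)]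
      rw [h2]; norm_num
    have hgoodT : T.HasGoodReductionAt u₃ := by
      refine T.hasGoodReductionAt_of_valuation_le_one_of_valuation_Δ_eq_one u₃ ?_ ?_ ?_ ?_ ?_ ?_
      · rw [hT₁, map_zero]; exact zero_le
      · rw [hT₂]; exact valuation_intCast_le_one u₃ hu₃ _
      · rw [hT₃, map_zero]; exact zero_le
      · rw [hT₄]; exact valuation_intCast_le_one u₃ hu₃ _
      · rw [hT₆]; exact valuation_intCast_le_one u₃ hu₃ _
      · rw [hTΔ, valuation_eq_one_iff_padicValuation_three u₃ hu₃]
        exact padicValuation_three_div_eq_one (by decide) hΔv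
    have hgoodVt : Vt.HasGoodReductionAt u₃ := (hasGoodReductionAt_smul_iff_holds u₃ Vt C3).mp hgoodT
    -- `Vt = (Ct * C₀ • W)^{(−3)} = C' • W^{(−3)}`
    have hVt : Vt = (⟨(Ct * C₀).u, (-3) * (Ct * C₀).r, 0, 0⟩ : VariableChange ℚ) • V := by
      rw [hVtdef, hMtdef, hMdef, ← mul_smul, hVdef]
      exact WeierstrassCurve.quadraticTwist_smul W (Ct * C₀) (-3)
    have hgoodV : V.HasGoodReductionAt u₃ := by
      rw [hVt] at hgoodVt
      exact (hasGoodReductionAt_smul_iff_holds u₃ V _).mp hgoodVt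
    exact hasGoodReductionAtPrime_of_hasGoodReductionAt V u₃ hu₃ hgoodV
  · -- Case non-minimal: contradiction
    exfalso
    set Ct : VariableChange ℚ := ⟨1, (t : ℚ), 0, 0⟩ with hCtdef
    set Mt := Ct • M with hMtdef
    have hMt₁ : Mt.a₁ = 0 := by rw [hMtdef, variableChange_a₁, hM₁, hCtdef]; simp
    have hMt₂ : Mt.a₂ = ((A + 3 * t : ℤ) : ℚ) := by
      rw [hMtdef, variableChange_a₂, hM₁, hM₂, hCtdef]; push_cast; simp
    have hMt₃ : Mt.a₃ = 0 := by rw [hMtdef, variableChange_a₃, hM₁, hM₃, hCtdef]; simp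
    have hMt₄ : Mt.a₄ = ((B + 2 * A * t + 3 * t ^ 2 : ℤ) : ℚ) := by
      rw [hMtdef, variableChange_a₄, hM₁, hM₂, hM₃, hM₄, hCtdef]; push_cast; simp; ring
    have hMt₆ : Mt.a₆ = ((C + B * t + A * t ^ 2 + t ^ 3 : ℤ) : ℚ) := by
      rw [hMtdef, variableChange_a₆, hM₁, hM₂, hM₃, hM₄, hM₆, hCtdef]; push_cast; simp; ring
    have hMtΔ : Mt.Δ = 2 ^ 12 * W.Δ := by rw [hMtdef, variableChange_Δ, hCtdef, hMΔ]; simp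
    set C3 : VariableChange ℚ := ⟨Units.mk0 (3 : ℚ) (by norm_num), 0, 0, 0⟩ with hC3def
    have hC3u : (↑C3.u⁻¹ : ℚ) = 3⁻¹ := by rw [Units.val_inv_eq_inv_val, hC3def, Units.val_mk0]
    set N := C3 • Mt with hNdef
    obtain ⟨y₂, hy₂⟩ := h9A
    obtain ⟨y₄, hy₄⟩ := h81B
    obtain ⟨y₆, hy₆⟩ := h729C
    have hN₁ : N.a₁ = 0 := by rw [hNdef, variableChange_a₁, hMt₁, hC3def]; simp
    have hN₃ : N.a₃ = 0 := by rw [hNdef, variableChange_a₃, hMt₁, hMt₃, hC3def]; simp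
    have hN₂ : N.a₂ = ((y₂ : ℤ) : ℚ) := by
      rw [hNdef, variableChange_a₂, hC3u, hMt₁, hMt₂, hy₂, hC3def]; push_cast; ring
    have hN₄ : N.a₄ = ((y₄ : ℤ) : ℚ) := by
      rw [hNdef, variableChange_a₄, hC3u, hMt₁, hMt₂, hMt₃, hMt₄, hy₄, hC3def]; push_cast; ring
    have hN₆ : N.a₆ = ((y₆ : ℤ) : ℚ) := by
      rw [hNdef, variableChange_a₆, hC3u, hMt₁, hMt₂, hMt₃, hMt₄, hMt₆, hy₆, hC3def]; push_cast; ring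
    have hNΔ : N.Δ = (3 : ℚ)⁻¹ ^ 12 * 2 ^ 12 * W.Δ := by
      rw [hNdef, variableChange_Δ, hC3u, hMtΔ]; ring
    have hint : N.IsIntegralAt u₃ := by
      refine N.isIntegralAt_of_valuation_le_one u₃ ?_ ?_ ?_ ?_ ?_
      · rw [hN₁, map_zero]; exact zero_le
      · rw [hN₂]; exact valuation_intCast_le_one u₃ hu₃ _
      · rw [hN₃, map_zero]; exact zero_le
      · rw [hN₄]; exact valuation_intCast_le_one u₃ hu₃ _
      · rw [hN₆]; exact valuation_intCast_le_one u₃ hu₃ _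
    have hN : (C3 * (Ct * C₀)) • W = N := by rw [mul_smul, mul_smul]
    have hmono := valuation_Δ_smul_le_of_isMinimalAt u₃ hmin (C3 * (Ct * C₀)) (hN ▸ hint)
    rw [hN, hNΔ, map_mul, map_mul] at hmono
    -- `u₃(2¹²) = 1`, `u₃(3⁻¹²) > 1`
    have hΔ0 : u₃.valuation ℚ W.Δ ≠ 0 := (Valuation.ne_zero_iff _).mpr W.isUnit_Δ.ne_zero
    have h2 : u₃.valuation ℚ ((2 : ℚ) ^ 12) = 1 := by
      rw [show ((2 : ℚ) ^ 12) = ((2 ^ 12 : ℤ) : ℚ) by norm_num,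
        valuation_eq_one_iff_padicValuation_three u₃ hu₃, Rat.padicValuation_cast,
        Int.padicValuation_eq_one_iff]
      decide
    rw [h2, mul_one] at hmono
    have h3lt : u₃.valuation ℚ (3 : ℚ) < 1 := by
      haveI : Fact (Nat.Prime ((Rat.HeightOneSpectrum.primesEquiv u₃ : Nat.Primes) : ℕ)) :=
        ⟨(Rat.HeightOneSpectrum.primesEquiv u₃).2⟩
      have hq : ((Rat.HeightOneSpectrum.primesEquiv u₃ : Nat.Primes) : ℕ) = 3 :=
        Rat.HeightOneSpectrum.primesEquiv_eq_of_natCast_mem u₃ Nat.prime_three hu₃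
      rw [(Rat.HeightOneSpectrum.valuation_equiv_padicValuation u₃).lt_one_iff_lt_one,
        padicValuation_apply_of_ne_zero _ (by norm_num : (3 : ℚ) ≠ 0), hq, ← exp_zero, exp_lt_exp,
        show (3 : ℚ) = ((3 : ℕ) : ℚ) by norm_num, padicValRat.self (by norm_num)]
      norm_num
    have h30 : u₃.valuation ℚ (3 : ℚ) ≠ 0 := (Valuation.ne_zero_iff _).mpr (by norm_num)
    have hone : (u₃.valuation ℚ (3 : ℚ))⁻¹ ^ 12 ≤ 1 := by
      rw [map_pow, map_inv₀] at hmono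
      calc (u₃.valuation ℚ (3 : ℚ))⁻¹ ^ 12
          = (u₃.valuation ℚ (3 : ℚ))⁻¹ ^ 12 * u₃.valuation ℚ W.Δ * (u₃.valuation ℚ W.Δ)⁻¹ := by
            rw [mul_inv_cancel_right₀ hΔ0]
        _ ≤ u₃.valuation ℚ W.Δ * (u₃.valuation ℚ W.Δ)⁻¹ := mul_le_mul' hmono le_rfl
        _ = 1 := mul_inv_cancel₀ hΔ0
    have hge : 1 ≤ u₃.valuation ℚ (3 : ℚ) := by
      rw [inv_pow] at hone
      have h := (inv_le_one₀ (pow_pos (zero_lt_iff.mpr h30) 12)).mp hone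
      exact (one_le_pow_iff_of_nonneg zero_le (by norm_num)).mp h
    exact absurd h3lt (not_lt.mpr hge)

/-- **Additive at `3` with `ord₃ j = 0` ⟹ Delbourgo's (G) at `3`** (`TypeG W 3`: good reduction of
`E` over the third cyclotomic field above `3`): the twist `E^{(−3)}` is good at `3`
(`hasGoodReductionAtPrime_twist_three_of_padicValRat_j_eq_zero`) and gen 0's
`typeG_of_hasGoodReductionAtPrime_quadraticTwist`. -/
theorem typeG_three_of_padicValRat_j_eq_zero (hadd : Addv W 3) (hj0 : W.j ≠ 0)
    (hj : padicValRat 3 W.j = 0) : TypeG W 3 :=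
  typeG_of_hasGoodReductionAtPrime_quadraticTwist W 3 (by norm_num)
    (hasGoodReductionAtPrime_twist_three_of_padicValRat_j_eq_zero W hadd hj0 hj)

end Main

end Summit.BirchSwinnertonDyer.Rank1Residual.Additive

end
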